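import Literature.AlgebraicGeometry.ModuliOfAbelianVarieties.SiegelFineModuliScheme
import Literature.AlgebraicGeometry.AbelianSchemes.PolarizedAbelianSchemeWithLevelBaseChange
import Literature.AlgebraicGeometry.Motives.AlgPoints
import HarnessLib

/-!
# FINE-MODULI POINTS: isomorphic pulled-back universal triples ⇒ EQUAL points of the Siegel fine moduli scheme
# ([MumfordFogartyKirwan1994] Ch. 7 §2 Def. 7.2–7.3, §3 Thm. 7.9; [Deligne1971TravauxShimura] 4.16)

Layer `Literature/AlgebraicGeometry/ModuliOfAbelianVarieties`, namespace `Literature.AlgebraicGeometry.ModuliOfAbelianVarieties.SiegelFineModuliScheme`.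
THEOREMS ONLY (no definition, no named fact, no instance, no notation, no `sorry`).  Cell `hodgecm-mathlib` (D-0151), P6 «MOD programme»
(crux hLiu418 = stmt-HodgeConjecture-24832, `--supports`, count-neutral); LEAD F0P6-plan (g3) «M-47» (2026-09-02T00:23:27Z): the organ
«FINE-MODULI POINTS: iso level-`N` tuples over `k̄` ⇒ equal `k̄`-points of `𝒜_{g,δ,N}`» for the P-line law `stub_INJ0` ∕ the provenance field `j_pts`,
over the ★ carrier `SiegelFineModuliScheme g N δ` (`classify` = the `∃!` half of representability) and the ★ relation
`PolarizedAbelianSchemeWithLevel.IsBaseChangeVia` (along `𝟙 T` = the moduli functor's ISOMORPHISM of triples, MFK Def. 7.2).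
HC_CM is proved only modulo the 2 remaining named inputs (hLiu418 24832, h413 24833) until rung 0 closes; nothing here is about HC.

THE MATHEMATICS.  A fine moduli scheme represents its functor, so a `T`-point `x : T → M` IS the classifying morphism of the pulled-back triple
`x^* univ` (uniqueness in `classify` against the canonical pull-back witness ★ `baseChange_isBaseChangeVia`), and ISOMORPHIC triples over `T` have the
SAME classifying morphism (compose the isomorphism — a five-clause relation along `𝟙 T` — with the classifying witness, ★ `IsBaseChangeVia.trans`).
Hence `x^* univ ≅ y^* univ` over `T` forces `x = y`; in particular two geometric points `Spec Ω → M` with isomorphic level-`N` triples are EQUAL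
([MumfordFogartyKirwan1994] p. 129: «`𝒜_{g,d,n}(S)` = the set of … up to isomorphism»; [Deligne1971TravauxShimura] 4.16: «le foncteur `F` est représenté»).
SCOPE (honest): the carrier is a `ℚ`-scheme and the test schemes are locally noetherian `ℚ`-schemes — so this is the CHARACTERISTIC-ZERO statement
(generic fibres, complex∕`ℚ̄`-points); the special-fibre form needs an integral fine-moduli carrier over `ℤ[1∕N∏δᵢ]` ([Lan2013PELCompactifications]
Thm. 1.4.1.11, Cor. 7.2.3.9), which the tree does not have (★ `lan2013_siegelFineModuliScheme` is `ℚ`-only by design) — the same three proofs apply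
verbatim to any carrier with a `classify` field.

* `eq_classifyingMap_baseChange` — `x = classifyingMap T (x^* univ)`.
* `classifyingMap_eq_of_isBaseChangeVia_id` — isomorphic triples over `T` have equal classifying morphisms.
* `eq_of_isBaseChangeVia_id`, `eq_iff_exists_isBaseChangeVia_id` — FINE-MODULI POINTS for `T`-points; `algPoints_eq_of_isBaseChangeVia_id` — for `Ω`-points.

## References
* [MumfordFogartyKirwan1994] D. Mumford, J. Fogarty, F. Kirwan, *Geometric Invariant Theory*, 3rd ed. (1994), Ch. 7 §2 Definitions 7.2–7.3 (p. 129),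
  Proposition 7.6 (p. 136), §3 Theorem 7.9 (p. 139).
* [Deligne1971TravauxShimura] P. Deligne, *Travaux de Shimura*, Sém. Bourbaki 389 (1971), 4.16 (p. 150).
* [Lan2013PELCompactifications] K.-W. Lan, *Arithmetic compactifications of PEL-type Shimura varieties* (2013), Thm. 1.4.1.11 (p. 91), Cor. 7.2.3.9 (p. 518).
-/

set_option autoImplicit false

noncomputable section

open CategoryTheory CategoryTheory.Limits AlgebraicGeometry

namespace Literature.AlgebraicGeometry.ModuliOfAbelianVarieties

namespace SiegelFineModuliScheme

open Literature.AlgebraicGeometry.Motives (SchemeOver AlgPoints specOver)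
open Literature.AlgebraicGeometry.AbelianSchemes (PolarizedAbelianSchemeWithLevel)

variable {g N : ℕ} {δ : Fin g → ℕ} (𝓜 : SiegelFineModuliScheme g N δ)

/-- **A `T`-point IS the classifying morphism of its pulled-back triple**: `x = classifyingMap T (x^* univ)` (uniqueness in `classify` against the
canonical pull-back witness ★ `baseChange_isBaseChangeVia`). [cite: MumfordFogartyKirwan1994, Ch. 7 §3 Theorem 7.9 (p. 139)] -/
theorem eq_classifyingMap_baseChange (T : SchemeOver ℚ) [IsLocallyNoetherian T.left] (x : T ⟶ 𝓜.M) :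
    x = 𝓜.classifyingMap T (𝓜.univ.baseChange x.left) :=
  𝓜.eq_classifyingMap T _ x ⟨_, _, 𝓜.univ.baseChange_isBaseChangeVia x.left⟩

/-- **Isomorphic triples have the same classifying morphism** (an isomorphism of triples over `T` = the five-clause relation along `𝟙 T`,
MFK Def. 7.2 «up to isomorphism»; compose it with the classifying witness, ★ `IsBaseChangeVia.trans`, and use uniqueness).
[cite: MumfordFogartyKirwan1994, Ch. 7 §2 Definition 7.2 (p. 129)] [cite: MumfordFogartyKirwan1994, Ch. 7 §3 Theorem 7.9 (p. 139)] -/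
theorem classifyingMap_eq_of_isBaseChangeVia_id (T : SchemeOver ℚ) [IsLocallyNoetherian T.left]
    (P₁ P₂ : PolarizedAbelianSchemeWithLevel g N δ T.left) {G : P₁.A.X.left ⟶ P₂.A.X.left} {Ĝ : P₁.D.hat.X.left ⟶ P₂.D.hat.X.left}
    (h : P₁.IsBaseChangeVia P₂ (𝟙 T.left) G Ĝ) :
    𝓜.classifyingMap T P₁ = 𝓜.classifyingMap T P₂ := by
  obtain ⟨G₀, Ĝ₀, h₀⟩ := 𝓜.exists_isBaseChangeVia_classifyingMap T P₂
  have h' := h.trans h₀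
  rw [Category.id_comp] at h'
  exact (𝓜.eq_classifyingMap T P₁ (𝓜.classifyingMap T P₂) ⟨_, _, h'⟩).symm

/-- **FINE-MODULI POINTS (`T`-points)**: two morphisms `x y : T → M` from a locally noetherian `ℚ`-scheme whose pulled-back universal triples are
ISOMORPHIC over `T` (five clauses along `𝟙 T`) are EQUAL. [cite: MumfordFogartyKirwan1994, Ch. 7 §3 Theorem 7.9 (p. 139)]
[cite: Deligne1971TravauxShimura, 4.16 p. 150] -/
theorem eq_of_isBaseChangeVia_id (T : SchemeOver ℚ) [IsLocallyNoetherian T.left] (x y : T ⟶ 𝓜.M)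
    {G : (𝓜.univ.baseChange x.left).A.X.left ⟶ (𝓜.univ.baseChange y.left).A.X.left}
    {Ĝ : (𝓜.univ.baseChange x.left).D.hat.X.left ⟶ (𝓜.univ.baseChange y.left).D.hat.X.left}
    (h : (𝓜.univ.baseChange x.left).IsBaseChangeVia (𝓜.univ.baseChange y.left) (𝟙 T.left) G Ĝ) : x = y :=
  (𝓜.eq_classifyingMap_baseChange T x).trans
    ((𝓜.classifyingMap_eq_of_isBaseChangeVia_id T _ _ h).trans (𝓜.eq_classifyingMap_baseChange T y).symm)

/-- **FINE-MODULI POINTS, `iff` form**: `x = y` iff the pulled-back universal triples are isomorphic over `T` (→ by ★ `IsBaseChangeVia.refl`).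
[cite: MumfordFogartyKirwan1994, Ch. 7 §3 Theorem 7.9 (p. 139)] -/
theorem eq_iff_exists_isBaseChangeVia_id (T : SchemeOver ℚ) [IsLocallyNoetherian T.left] (x y : T ⟶ 𝓜.M) :
    x = y ↔ ∃ (G : (𝓜.univ.baseChange x.left).A.X.left ⟶ (𝓜.univ.baseChange y.left).A.X.left)
      (Ĝ : (𝓜.univ.baseChange x.left).D.hat.X.left ⟶ (𝓜.univ.baseChange y.left).D.hat.X.left),
      (𝓜.univ.baseChange x.left).IsBaseChangeVia (𝓜.univ.baseChange y.left) (𝟙 T.left) G Ĝ := by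
  refine ⟨fun hxy => ?_, fun ⟨_, _, h⟩ => 𝓜.eq_of_isBaseChangeVia_id T x y h⟩
  subst hxy
  exact ⟨_, _, PolarizedAbelianSchemeWithLevel.IsBaseChangeVia.refl _⟩

/-- **FINE-MODULI POINTS for `Ω`-valued points** (`Ω ⊇ ℚ` any field, e.g. `ℂ` or `ℚ̄`): two points `x y ∈ M(Ω)` whose level-`N` triples
`x^* univ`, `y^* univ` over `Spec Ω` are isomorphic are EQUAL — «for `n ≥ 3` the functor is represented» read on field-valued points.
[cite: MumfordFogartyKirwan1994, Ch. 7 §3 Theorem 7.9 (p. 139)] [cite: Deligne1971TravauxShimura, 4.16 p. 150] -/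
theorem algPoints_eq_of_isBaseChangeVia_id {Ω : Type} [Field Ω] [Algebra ℚ Ω] (x y : AlgPoints 𝓜.M Ω)
    {G : (𝓜.univ.baseChange x.left).A.X.left ⟶ (𝓜.univ.baseChange y.left).A.X.left}
    {Ĝ : (𝓜.univ.baseChange x.left).D.hat.X.left ⟶ (𝓜.univ.baseChange y.left).D.hat.X.left}
    (h : (𝓜.univ.baseChange x.left).IsBaseChangeVia (𝓜.univ.baseChange y.left) (𝟙 _) G Ĝ) : x = y :=
  haveI : IsLocallyNoetherian (specOver ℚ Ω).left := by
    change IsLocallyNoetherian (Spec (.of Ω))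
    infer_instance
  𝓜.eq_of_isBaseChangeVia_id (specOver ℚ Ω) x y h

end SiegelFineModuliScheme

end Literature.AlgebraicGeometry.ModuliOfAbelianVarieties

end
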